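import Summits.Ventures.CertifiedManyBodySolver.Observables.StiffnessApexTransportDoped
import HarnessLib

/-!
# Ventures/CertifiedManyBodySolver — Observables/StiffnessApexTransportDopedBracket.lean

HONEST FRAMING: one-sided certified CEILINGS on the uniform flux stiffness (t–t′ f-sum class) at ANY density, transported by the
apex rule; conditional on the source rows named; a ceiling never speaks to the presence of order; not a `T_c` estimate, not a
superconductivity verdict. Zero compute, no definition, no claim node, no `sorry`.

Cell `pub/hubbard-downfold` (D-0150 L-DF2 «box ↦ one word»), seat `hubbard-downfold-unc-2` (`prover-hubbard-downfold-unc-2-g14-0`); companion of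
`Observables/StiffnessApexTransportDoped.lean` (append of the same session; separate file to respect the 400-line rule).

* §1 **TWO POINT SOURCES BRACKETING THE TARGET word it with NO `K₂` input on the target class** (`HubbardTTPrimeApexRowDoped` §7):
  sources `s₁ < s₂` at the station `U_A`, target `P = (t′_P, U_P)` whose apex-segment parameter lies between them
  (`κ₁ ≤ 2t′_P ≤ κ₂` for the apex hoppings `κ_i = (U_P s_i − U_A t′_P)/(U_P − U_A)`), floor orientation `2s_i ≤ κ_i`, floors `B_i ≤ K₂` on
  the two source classes ⇒ `ObsStiffnessSeqCeilingAt t′_P U_P n c` for `c ≥ max_i(−r_i − (κ_i − 2s_i)B_i/4)`: affine interpolation in the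
  hopping slot happens AT THE TARGET, so finitely many point parents at a station cover 2-D patches at any density — the doped analogue of
  the one-point region at `n = 1` (`StiffnessApexTransport` §5), the dual-free insurance of the box plan;
* §2 the same with ONE floor word at the right source `s₂` (a floor word moves LEFT along `t′`);
* §3 the leaf of the companion's §1 with the `K₂` floor in PARTICLE–HOLE WINDOW form: cap at the source + energy floor at the SAME hopping and
  the reflected density `2 − n` (`HubbardTTPrimeApexRowDoped` §6) — near half filling both rows are one window certificate read at two densities.

References: T. Koma, H. Tasaki, J. Stat. Phys. 76 (1994) 745, §1 [KomaTasaki1994]; D. J. Scalapino, S. R. White, S.-C. Zhang, PRB 47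
(1993) 7995, §II [ScalapinoWhiteZhang1993]; E. H. Lieb, F. Y. Wu, Physica A 321 (2003) 1, §1 eq. (3) [LiebWuPhysicaA2003].
-/

noncomputable section

namespace Summit.Ventures.CertifiedManyBodySolver.Observables

open Literature.MathematicalPhysics.QuantumLattice
open Literature.MathematicalPhysics.QuantumLattice.ThermodynamicLimit
open Literature.MathematicalPhysics.QuantumFieldTheory
open Literature.Probability.LatticeModels
open Matrix Finset Filter Topology HubbardWave0
open scoped Matrix BigOperators ComplexOrder

/-! ## §1 Two point sources bracketing the target -/

section Bracket

variable {UA s₁ s₂ n : ℝ}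

/-- **Two-source bracket leaf (any density).** Station `U_A ≥ 0`; two certified f-sum orbit rows `r_i ≤ |D₄|⁻¹Σ_γ Re ω_γ(−X₀(s_i))` at
`(s_i, U_A, n)` (`s₁ < s₂`, caps `u_i` certified) with floors `B_i ≤ K₂` on their classes; a target `(t′_P, U_P)`, `U_A < U_P`, with
`U_P s₁ − U_A t′_P ≤ 2t′_P(U_P − U_A) ≤ U_P s₂ − U_A t′_P` (bracket) and `2s_i(U_P − U_A) ≤ U_P s_i − U_A t′_P` (floor orientation). Then
`ObsStiffnessSeqCeilingAt t′_P U_P n c` for every `c` with `−r_i − (κ_i − 2s_i)B_i/4 ≤ c` (`i = 1, 2`; `κ_i = (U_P s_i − U_A t′_P)/(U_P − U_A)`).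
[cite: KomaTasaki1994, §1] [cite: ScalapinoWhiteZhang1993, §II] -/
theorem ObsStiffnessSeqCeilingAt_of_two_apexSources_of_le_diagHop (Uo₁ Uo₂ : ℝ) (hUA : 0 ≤ UA) (hs : s₁ < s₂)
    (hn0 : 0 ≤ n) (hn2 : n < 2) {u₁ r₁ u₂ r₂ : ℚ}
    (hrow₁ : SquareTTPrimeCorrOrbitLowerRow s₁ UA n u₁ r₁ Finset.univ (box 2 7) (-oddMomentObsTT s₁ Uo₁ 0))
    (hu₁ : energyDensityTT' 1 s₁ UA n ≤ ((u₁ : ℚ) : ℝ))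
    (hrow₂ : SquareTTPrimeCorrOrbitLowerRow s₂ UA n u₂ r₂ Finset.univ (box 2 7) (-oddMomentObsTT s₂ Uo₂ 0))
    (hu₂ : energyDensityTT' 1 s₂ UA n ≤ ((u₂ : ℚ) : ℝ)) {B₁ B₂ : ℝ}
    (hB₁ : ∀ (ω : InfVolFermionState 2) (Ls : ℕ → ℕ) (ψ : ∀ L, Fock (Orb (FermionTorus 2 L))),
      Tendsto Ls atTop atTop →
      (∀ j, IsGroundStateInSector (hubbardTorusTT' (Ls j) 1 s₁ UA) (rectN n (Ls j)) 0 (ψ (Ls j))) →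
      (∀ j, star (ψ (Ls j)) ⬝ᵥ ψ (Ls j) = 1) → ω.IsTorusLimitOf ψ Ls →
      B₁ ≤ ω.meanEnergy (hubbardTTPrimeFermionInteraction 0 1 0) 1)
    (hB₂ : ∀ (ω : InfVolFermionState 2) (Ls : ℕ → ℕ) (ψ : ∀ L, Fock (Orb (FermionTorus 2 L))),
      Tendsto Ls atTop atTop →
      (∀ j, IsGroundStateInSector (hubbardTorusTT' (Ls j) 1 s₂ UA) (rectN n (Ls j)) 0 (ψ (Ls j))) →
      (∀ j, star (ψ (Ls j)) ⬝ᵥ ψ (Ls j) = 1) → ω.IsTorusLimitOf ψ Ls →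
      B₂ ≤ ω.meanEnergy (hubbardTTPrimeFermionInteraction 0 1 0) 1)
    {t'P UP : ℝ} (hU : UA < UP)
    (hlo : UP * s₁ - UA * t'P ≤ 2 * t'P * (UP - UA)) (hhi : 2 * t'P * (UP - UA) ≤ UP * s₂ - UA * t'P)
    (h2s₁ : 2 * s₁ * (UP - UA) ≤ UP * s₁ - UA * t'P) (h2s₂ : 2 * s₂ * (UP - UA) ≤ UP * s₂ - UA * t'P) (c : ℚ)
    (hc₁ : -((r₁ : ℚ) : ℝ) - ((UP * s₁ - UA * t'P) / (UP - UA) - 2 * s₁) * B₁ / 4 ≤ ((c : ℚ) : ℝ))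
    (hc₂ : -((r₂ : ℚ) : ℝ) - ((UP * s₂ - UA * t'P) / (UP - UA) - 2 * s₂) * B₂ / 4 ≤ ((c : ℚ) : ℝ)) :
    ObsStiffnessSeqCeilingAt t'P UP n c := by
  intro ρs θ₀ _ hθ₀ Ls hLs hst
  refine fluxStiffness_le_of_torusLimitTT'_oddMoment_orbit_certificate_seq t'P (U := UP) (δ := 1 - n) (q := ((c : ℚ) : ℝ)) 0
    Finset.univ Finset.univ_nonempty (by linarith) (by linarith) hθ₀ hLs hst ?_
  intro ω Ms ψ hMs hψ h1 hω
  have hψ' : ∀ j, IsGroundStateInSector (hubbardTorusTT' (Ms j) 1 t'P UP) (rectN n (Ms j)) 0 (ψ (Ms j)) := fun j => by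
    simpa only [sub_sub_cancel] using hψ j
  rw [orbitMean_rotOddMomentLimitFunctionalTT_lam_zero_eq_meanEnergy_twice_tPrime hω.isTranslationInvariant]
  obtain ⟨φ₁, g₁, ω₁, hg₁, hφ₁, hφ₁1, hω₁, -, -, -⟩ :=
    exists_isTorusLimitOf_sectorGroundState_TT' 1 s₁ UA hn0 hn2.le (Ls := id) tendsto_id
  obtain ⟨φ₂, g₂, ω₂, hg₂, hφ₂, hφ₂1, hω₂, -, -, -⟩ :=
    exists_isTorusLimitOf_sectorGroundState_TT' 1 s₂ UA hn0 hn2.le (Ls := id) tendsto_id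
  have hL₁ : Tendsto (id ∘ g₁ : ℕ → ℕ) atTop atTop := tendsto_id.comp hg₁.tendsto_atTop
  have hL₂ : Tendsto (id ∘ g₂ : ℕ → ℕ) atTop atTop := tendsto_id.comp hg₂.tendsto_atTop
  have hmin := InfVolFermionState.IsTorusLimitOf.min_twice_source_add_le_of_groundStates_twoApexSources 1 s₁ s₂ t'P hUA hU hs
    hlo hhi h2s₁ h2s₂ hn0 hn2 hω₁ hL₁ (fun j => hφ₁ _) (fun j => hφ₁1 _) hω₂ hL₂ (fun j => hφ₂ _) (fun j => hφ₂1 _)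
    hω hMs hψ' h1 (hB₁ ω₁ (id ∘ g₁) φ₁ hL₁ (fun j => hφ₁ _) (fun j => hφ₁1 _) hω₁)
    (hB₂ ω₂ (id ∘ g₂) φ₂ hL₂ (fun j => hφ₂ _) (fun j => hφ₂1 _) hω₂)
  have hv₁ := hrow₁ ω₁ (id ∘ g₁) φ₁ hL₁ (fun j => hφ₁ _) (fun j => hφ₁1 _) hω₁ hu₁
  rw [orbitMean_re_expect_neg_oddMomentTT_lam_zero hω₁.isTranslationInvariant] at hv₁
  have hv₂ := hrow₂ ω₂ (id ∘ g₂) φ₂ hL₂ (fun j => hφ₂ _) (fun j => hφ₂1 _) hω₂ hu₂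
  rw [orbitMean_re_expect_neg_oddMomentTT_lam_zero hω₂.isTranslationInvariant] at hv₂
  rcases min_le_iff.1 hmin with h | h <;> linarith

/-- **Two-source bracket with ONE `K₂` floor word** (at the right source `s₂`; a floor word moves left along `t′` so it serves `s₁` too,
`IsTorusLimitOf.le_meanEnergy_diagHop_of_forall_right`). [cite: KomaTasaki1994, §1] [cite: ScalapinoWhiteZhang1993, §II] -/
theorem ObsStiffnessSeqCeilingAt_of_two_apexSources_of_rightDiagHopFloor (Uo₁ Uo₂ : ℝ) (hUA : 0 ≤ UA) (hs : s₁ < s₂)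
    (hn0 : 0 ≤ n) (hn2 : n < 2) {u₁ r₁ u₂ r₂ : ℚ}
    (hrow₁ : SquareTTPrimeCorrOrbitLowerRow s₁ UA n u₁ r₁ Finset.univ (box 2 7) (-oddMomentObsTT s₁ Uo₁ 0))
    (hu₁ : energyDensityTT' 1 s₁ UA n ≤ ((u₁ : ℚ) : ℝ))
    (hrow₂ : SquareTTPrimeCorrOrbitLowerRow s₂ UA n u₂ r₂ Finset.univ (box 2 7) (-oddMomentObsTT s₂ Uo₂ 0))
    (hu₂ : energyDensityTT' 1 s₂ UA n ≤ ((u₂ : ℚ) : ℝ)) {B : ℝ}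
    (hB₂ : ∀ (ω : InfVolFermionState 2) (Ls : ℕ → ℕ) (ψ : ∀ L, Fock (Orb (FermionTorus 2 L))),
      Tendsto Ls atTop atTop →
      (∀ j, IsGroundStateInSector (hubbardTorusTT' (Ls j) 1 s₂ UA) (rectN n (Ls j)) 0 (ψ (Ls j))) →
      (∀ j, star (ψ (Ls j)) ⬝ᵥ ψ (Ls j) = 1) → ω.IsTorusLimitOf ψ Ls →
      B ≤ ω.meanEnergy (hubbardTTPrimeFermionInteraction 0 1 0) 1)
    {t'P UP : ℝ} (hU : UA < UP)
    (hlo : UP * s₁ - UA * t'P ≤ 2 * t'P * (UP - UA)) (hhi : 2 * t'P * (UP - UA) ≤ UP * s₂ - UA * t'P)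
    (h2s₁ : 2 * s₁ * (UP - UA) ≤ UP * s₁ - UA * t'P) (h2s₂ : 2 * s₂ * (UP - UA) ≤ UP * s₂ - UA * t'P) (c : ℚ)
    (hc₁ : -((r₁ : ℚ) : ℝ) - ((UP * s₁ - UA * t'P) / (UP - UA) - 2 * s₁) * B / 4 ≤ ((c : ℚ) : ℝ))
    (hc₂ : -((r₂ : ℚ) : ℝ) - ((UP * s₂ - UA * t'P) / (UP - UA) - 2 * s₂) * B / 4 ≤ ((c : ℚ) : ℝ)) :
    ObsStiffnessSeqCeilingAt t'P UP n c :=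
  ObsStiffnessSeqCeilingAt_of_two_apexSources_of_le_diagHop Uo₁ Uo₂ hUA hs hn0 hn2 hrow₁ hu₁ hrow₂ hu₂
    (fun _ω _Ls _ψ hLs hψ h1 hω =>
      InfVolFermionState.IsTorusLimitOf.le_meanEnergy_diagHop_of_forall_right 1 hs.le hUA hn0 hn2 hB₂ hω hLs hψ h1)
    hB₂ hU hlo hhi h2s₁ h2s₂ c hc₁ hc₂

end Bracket

/-! ## §3 The leaf with the `K₂` floor in particle–hole window form -/

section PHWindow

variable {t'P UP t'A UA n : ℝ}

/-- **Doped apex leaf, particle–hole window edition** (`t′_A < 0`, `0 < n < 2`): the source's f-sum orbit row `r` under its cap `u`, plus a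
certified floor `l₂ ≤ e₀(1, t′_A, U_A, 2 − n)` at the SAME hopping and the reflected density, give `ObsStiffnessSeqCeilingAt t′_P U_P n c` for
`c ≥ −r − (t′_P − t′_A)·((u − l₂ − U_A(n − 1))/(2t′_A))/2` (`K₂ ≥ (u − l₂ − U_A(n−1))/(2t′_A)`, `HubbardTTPrimeApexRowDoped` §6). Near `n = 1`
both energy rows are one window certificate read at the two densities, so the doped price is the window width times the lever.
[cite: KomaTasaki1994, §1] [cite: LiebWuPhysicaA2003, §1 eq. (3)] -/
theorem ObsStiffnessSeqCeilingAt_of_apexSource_fsumRow_particleHoleWindow (Uo : ℝ) (hUA : 0 ≤ UA) (hU : UA < UP)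
    (hapex : UP * t'A = (2 * UP - UA) * t'P) (ht'A : t'A < 0) (ht : t'A ≤ t'P) (hn0 : 0 < n) (hn2 : n < 2)
    {u r : ℚ} (hrow : SquareTTPrimeCorrOrbitLowerRow t'A UA n u r Finset.univ (box 2 7) (-oddMomentObsTT t'A Uo 0))
    (hu : energyDensityTT' 1 t'A UA n ≤ ((u : ℚ) : ℝ)) {l₂ : ℝ} (hl : l₂ ≤ energyDensityTT' 1 t'A UA (2 - n)) (c : ℚ)
    (hc : -((r : ℚ) : ℝ) - (t'P - t'A) * ((((u : ℚ) : ℝ) - l₂ - UA * (n - 1)) / (2 * t'A)) / 2 ≤ ((c : ℚ) : ℝ)) :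
    ObsStiffnessSeqCeilingAt t'P UP n c :=
  ObsStiffnessSeqCeilingAt_of_apexSource_fsumRow_of_le_diagHop Uo hUA hU hapex ht hn0.le hn2 hrow hu
    (fun _ω _Ls _ψ hLs hψ h1 hω =>
      InfVolFermionState.IsTorusLimitOf.div_le_diagHop_of_particleHole_window_of_neg 1 ht'A hUA hn0 hn2 hu hl hω hLs hψ h1)
    c hc

end PHWindow

/-! ## §4 (append, same seat) The `K₂` FLOOR word from a claim node in the row-of-record shape, and the node-fed doped box -/

section DiagHopFloorRow

/-- **DICTIONARY: the `D₄`-orbit mean of `−X_K2` is `+K₂`.** `X_K2 = 2·(X₀(1) − X₀(0))` (hubbard-obs p2's `K₂` observable,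
`Certificates/HubbardSquare_LaBoxE_n1_bootstrap_K2row`); for translation-invariant `ω`,
`|D₄|⁻¹ Σ_γ Re ω_{γΛ₇}(Γ_γ(−X_K2)) = ω.meanEnergy (hubbardTTPrimeFermionInteraction 0 1 0) 1` (from `−¼(K₁ + 2K₂)` and `−¼K₁`, doubled and negated).
[cite: HazraVermaRanderia2019, eq. (4)] -/
theorem orbitMean_negDiagHopObs_eq_meanEnergy_diagHop {ω : InfVolFermionState 2} (hω : ω.IsTranslationInvariant) (Uo : ℝ) :
    ((Finset.univ : Finset (DihedralGroup 4)).card : ℝ)⁻¹ * ∑ γ ∈ (Finset.univ : Finset (DihedralGroup 4)),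
        (ω.expect (d4ShiftSet γ 0 (box 2 7)) (fermionEmbed (PolySite.d4Emb γ 0 (box 2 7))
          (-(((2 : ℝ) : ℂ) • (oddMomentObsTT 1 Uo 0 - oddMomentObsTT 0 Uo 0))))).re =
      ω.meanEnergy (hubbardTTPrimeFermionInteraction 0 1 0) 1 := by
  have hγ : ∀ γ : DihedralGroup 4,
      (ω.expect (d4ShiftSet γ 0 (box 2 7)) (fermionEmbed (PolySite.d4Emb γ 0 (box 2 7))
          (-(((2 : ℝ) : ℂ) • (oddMomentObsTT 1 Uo 0 - oddMomentObsTT 0 Uo 0))))).re =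
        -(2 * (rotOddMomentLimitFunctionalTT 1 Uo 0 γ ω - rotOddMomentLimitFunctionalTT 0 Uo 0 γ ω)) := by
    intro γ
    unfold rotOddMomentLimitFunctionalTT
    rw [map_neg, map_neg, Complex.neg_re, fermionEmbed_smul, fermionEmbed_sub, map_smul, map_sub, smul_eq_mul,
      Complex.re_ofReal_mul, Complex.sub_re]
  have h1 := orbitMean_rotOddMomentLimitFunctionalTT_lam_zero_eq_meanEnergy_twice_tPrime hω 1 Uo
  have h0 := orbitMean_rotOddMomentLimitFunctionalTT_lam_zero_eq_meanEnergy_twice_tPrime hω 0 Uo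
  rw [ω.meanEnergy_hubbardTTPrime_eq_coords 1 (2 * 1) 0] at h1
  rw [ω.meanEnergy_hubbardTTPrime_eq_coords 1 (2 * 0) 0] at h0
  simp_rw [hγ]
  rw [Finset.sum_neg_distrib, ← Finset.mul_sum, Finset.sum_sub_distrib]
  linear_combination (-(2 : ℝ)) * h1 + (2 : ℝ) * h0

variable {s₁ U n : ℝ}

/-- **A `K₂` FLOOR WORD FROM A ROW OF RECORD on `−X_K2`.** If `e(1, s₁, U, n) ≤ u` and the `D₄`-orbit-mean LOWER row
`SquareTTPrimeCorrOrbitLowerRow s₁ U n u r univ (box 2 7) (−X_K2)` holds (a certificate `r ≤ ω(K2diag)` — the solver MINIMISES `ω(K2diag)`), then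
every torus-limit ground state of the class has **`r ≤ K₂(ω)`** — the hypothesis shape `hB`/`hBq` of the doped box theorems with `B := r` (the mirror of
hubbard-obs p2's `forall_torusLimit_diagHop_le_of_orbitLowerRow`, which reads the `+X_K2` row as the CEILING `K₂ ≤ −r`). [cite: BoydVandenberghe2004, §5.9] [cite: KomaTasaki1994, §1] -/
theorem forall_torusLimit_le_diagHop_of_orbitLowerRow_neg (Uo : ℝ) {u r : ℚ} (hcap : energyDensityTT' 1 s₁ U n ≤ ((u : ℚ) : ℝ))
    (hrow : SquareTTPrimeCorrOrbitLowerRow s₁ U n u r Finset.univ (box 2 7)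
      (-(((2 : ℝ) : ℂ) • (oddMomentObsTT 1 Uo 0 - oddMomentObsTT 0 Uo 0)))) :
    ∀ (ω : InfVolFermionState 2) (Ls : ℕ → ℕ) (ψ : ∀ L, Fock (Orb (FermionTorus 2 L))),
      Tendsto Ls atTop atTop →
      (∀ j, IsGroundStateInSector (hubbardTorusTT' (Ls j) 1 s₁ U) (rectN n (Ls j)) 0 (ψ (Ls j))) →
      (∀ j, star (ψ (Ls j)) ⬝ᵥ ψ (Ls j) = 1) → ω.IsTorusLimitOf ψ Ls →
      ((r : ℚ) : ℝ) ≤ ω.meanEnergy (hubbardTTPrimeFermionInteraction 0 1 0) 1 := by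
  intro ω Ls ψ hLs hψ h1 hω
  have h := hrow ω Ls ψ hLs hψ h1 hω hcap
  rwa [orbitMean_negDiagHopObs_eq_meanEnergy_diagHop hω.isTranslationInvariant] at h

end DiagHopFloorRow

section NodeFedBox

variable {UA Umax p q n : ℝ}

/-- **THE DOPED BOX FROM ONE STATION, node-fed.** As `…_on_box_of_forall_apexStation_orbitLower_of_cornerDiagHopFloor`, with the `K₂` floor supplied
by ONE claim node in the row-of-record shape at the inner bottom corner `(q, U_A, n)`: `SquareTTPrimeCorrOrbitLowerRow q U_A n u_q r_q univ (box 2 7) (−X_K2)`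
under a certified cap `u_q`, with `r_q ≤ 0` (a floor can always be weakened to `min(r_q, 0)`). Then `ObsStiffnessSeqCeilingAt t′ U n c` on the whole box
`[p, q] × [U_A, U_max]` for every `c` with `−val s + (−p)(1 − U_A/U_max)(−r_q)/2 ≤ c` on the source segment. [cite: KomaTasaki1994, §1] [cite: ScalapinoWhiteZhang1993, §II] -/
theorem ObsStiffnessSeqCeilingAt_on_box_of_forall_apexStation_orbitLower_of_cornerDiagHopRow (Uo : ℝ) (hUA : 0 < UA)
    (hq : q ≤ 0) (hn0 : 0 ≤ n) (hn2 : n < 2) (val : ℝ → ℝ) {uq rq : ℚ} (hrq : rq ≤ 0)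
    (hcapq : energyDensityTT' 1 q UA n ≤ ((uq : ℚ) : ℝ))
    (hrowq : SquareTTPrimeCorrOrbitLowerRow q UA n uq rq Finset.univ (box 2 7)
      (-(((2 : ℝ) : ℂ) • (oddMomentObsTT 1 Uo 0 - oddMomentObsTT 0 Uo 0)))) (c : ℚ)
    (h : ∀ s ∈ Set.Icc (p * (2 - UA / Umax)) q,
      ∀ (ω : InfVolFermionState 2) (Ls : ℕ → ℕ) (ψ : ∀ L, Fock (Orb (FermionTorus 2 L))),
      Tendsto Ls atTop atTop →
      (∀ j, IsGroundStateInSector (hubbardTorusTT' (Ls j) 1 s UA) (rectN n (Ls j)) 0 (ψ (Ls j))) →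
      (∀ j, star (ψ (Ls j)) ⬝ᵥ ψ (Ls j) = 1) → ω.IsTorusLimitOf ψ Ls →
      val s ≤ ((Finset.univ : Finset (DihedralGroup 4)).card : ℝ)⁻¹ * ∑ g ∈ (Finset.univ : Finset (DihedralGroup 4)),
        (ω.expect (d4ShiftSet g 0 (box 2 7)) (fermionEmbed (PolySite.d4Emb g 0 (box 2 7)) (-oddMomentObsTT s UA 0))).re)
    (hc : ∀ s ∈ Set.Icc (p * (2 - UA / Umax)) q,
      -val s + (-p) * (1 - UA / Umax) * (-((rq : ℚ) : ℝ)) / 2 ≤ ((c : ℚ) : ℝ)) :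
    ∀ tp ∈ Set.Icc p q, ∀ U ∈ Set.Icc UA Umax, ObsStiffnessSeqCeilingAt tp U n c :=
  ObsStiffnessSeqCeilingAt_on_box_of_forall_apexStation_orbitLower_of_cornerDiagHopFloor hUA hq hn0 hn2 val
    (B := ((rq : ℚ) : ℝ)) (by exact_mod_cast hrq) c h (forall_torusLimit_le_diagHop_of_orbitLowerRow_neg Uo hcapq hrowq) hc

end NodeFedBox

/-! ## §5 (append, same seat) The other orientation and the sign-free kinematic leaf; the region with a kinematic target floor -/

section Orientation

variable {t'P UP t'A UA n : ℝ}

/-- **Doped apex leaf, CEILING orientation** (`t′_P ≤ t′_A`: the `t′ ≥ 0` side, or a source at smaller `|t′|`): the source's f-sum orbit row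
`r` under its cap `u`, plus a CEILING `K₂ ≤ A` on the source class, give `ObsStiffnessSeqCeilingAt t′_P U_P n c` for every
`c ≥ −r − (t′_P − t′_A)·A/2` (the coefficient `t′_P − t′_A ≤ 0`). [cite: KomaTasaki1994, §1] [cite: ScalapinoWhiteZhang1993, §II] -/
theorem ObsStiffnessSeqCeilingAt_of_apexSource_fsumRow_of_diagHop_le (Uo : ℝ) (hUA : 0 ≤ UA) (hU : UA < UP)
    (hapex : UP * t'A = (2 * UP - UA) * t'P) (ht : t'P ≤ t'A) (hn0 : 0 ≤ n) (hn2 : n < 2) {u r : ℚ}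
    (hrow : SquareTTPrimeCorrOrbitLowerRow t'A UA n u r Finset.univ (box 2 7) (-oddMomentObsTT t'A Uo 0))
    (hu : energyDensityTT' 1 t'A UA n ≤ ((u : ℚ) : ℝ)) {A : ℝ}
    (hA : ∀ (ω : InfVolFermionState 2) (Ls : ℕ → ℕ) (ψ : ∀ L, Fock (Orb (FermionTorus 2 L))),
      Tendsto Ls atTop atTop →
      (∀ j, IsGroundStateInSector (hubbardTorusTT' (Ls j) 1 t'A UA) (rectN n (Ls j)) 0 (ψ (Ls j))) →
      (∀ j, star (ψ (Ls j)) ⬝ᵥ ψ (Ls j) = 1) → ω.IsTorusLimitOf ψ Ls →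
      ω.meanEnergy (hubbardTTPrimeFermionInteraction 0 1 0) 1 ≤ A)
    (c : ℚ) (hc : -((r : ℚ) : ℝ) - (t'P - t'A) * A / 2 ≤ ((c : ℚ) : ℝ)) :
    ObsStiffnessSeqCeilingAt t'P UP n c := by
  refine ObsStiffnessSeqCeilingAt_of_forall_apexSource_oneBody_ge hUA hU hapex hn0 hn2
    (ℓ := 4 * ((r : ℚ) : ℝ) + 2 * (t'P - t'A) * A) (fun ω Ls ψ hLs hψ h1 hω => ?_) c (by linarith)
  have h := hrow ω Ls ψ hLs hψ h1 hω hu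
  rw [orbitMean_re_expect_neg_oddMomentTT_lam_zero hω.isTranslationInvariant] at h
  have hcmp := InfVolFermionState.meanEnergy_hopping_le_add_mul_of_diagHop_le ω 1 (κ := 2 * t'P) (κ' := 2 * t'A)
    (by linarith) (hA ω Ls ψ hLs hψ h1 hω)
  have e : (2 * t'A - 2 * t'P) * A = -(2 * (t'P - t'A) * A) := by ring
  linarith

/-- **Doped apex leaf, SIGN-FREE KINEMATIC edition** (either orientation; no `K₂` input): `c ≥ −r + 0.8105695·|t′_P − t′_A|` suffices
(`|K₂| ≤ 1.6211390` on every class, `IsTorusLimitOf.abs_meanEnergy_diagHop_le_decimal`). [cite: LiebLoss1993, §8, Theorem 8.2] [cite: ScalapinoWhiteZhang1993, §II] -/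
theorem ObsStiffnessSeqCeilingAt_of_apexSource_fsumRow_kinematic_abs (Uo : ℝ) (hUA : 0 ≤ UA) (hU : UA < UP)
    (hapex : UP * t'A = (2 * UP - UA) * t'P) (hn0 : 0 ≤ n) (hn2 : n < 2) {u r : ℚ}
    (hrow : SquareTTPrimeCorrOrbitLowerRow t'A UA n u r Finset.univ (box 2 7) (-oddMomentObsTT t'A Uo 0))
    (hu : energyDensityTT' 1 t'A UA n ≤ ((u : ℚ) : ℝ)) (c : ℚ)
    (hc : -((r : ℚ) : ℝ) + 0.8105695 * |t'P - t'A| ≤ ((c : ℚ) : ℝ)) :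
    ObsStiffnessSeqCeilingAt t'P UP n c := by
  rcases le_total t'A t'P with ht | ht
  · refine ObsStiffnessSeqCeilingAt_of_apexSource_fsumRow_kinematic Uo hUA hU hapex ht hn0 hn2 hrow hu c ?_
    rwa [abs_of_nonneg (sub_nonneg.2 ht)] at hc
  · refine ObsStiffnessSeqCeilingAt_of_apexSource_fsumRow_of_diagHop_le Uo hUA hU hapex ht hn0 hn2 hrow hu
      (A := (1.6211390 : ℝ)) (fun ω Ls ψ hLs hψ h1 hω => ?_) c ?_
    · have hN : ∀ j, IsNParticle (rectN n (Ls j)) (ψ (Ls j)) := fun j => ((mem_szSector_iff _ _ _).1 (hψ j).1).1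
      exact (abs_le.1 (hω.abs_meanEnergy_diagHop_le_decimal hn0 hn2 hLs hN h1)).2
    · rw [abs_of_nonpos (sub_nonpos.2 ht)] at hc
      linarith

end Orientation

section RegionKinematicTarget

variable {t'A UA n : ℝ}

/-- **One corner row words a thin 2-D LENS at any density with NO word on the target class**: the region leaf of the companion
(`…_on_apexRegion_of_fsumRow_of_le_diagHop`) with the KINEMATIC target-side floor `−1.6211390 ≤ K₂(ω_P)`; price
`(κ − 2t′_A)(−B_A)/4 + (2t′_P − κ)·1.6211390/4`, small when the target is close to the source's apex curve (`2t′_P − κ` small).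
[cite: LiebLoss1993, §8, Theorem 8.2] [cite: ScalapinoWhiteZhang1993, §II] -/
theorem ObsStiffnessSeqCeilingAt_on_apexRegion_of_fsumRow_of_le_diagHop_kinematicTarget (Uo : ℝ) (hUA : 0 ≤ UA)
    (hn0 : 0 ≤ n) (hn2 : n < 2) {u r : ℚ}
    (hrow : SquareTTPrimeCorrOrbitLowerRow t'A UA n u r Finset.univ (box 2 7) (-oddMomentObsTT t'A Uo 0))
    (hu : energyDensityTT' 1 t'A UA n ≤ ((u : ℚ) : ℝ)) {BA : ℝ}
    (hBA : ∀ (ω : InfVolFermionState 2) (Ls : ℕ → ℕ) (ψ : ∀ L, Fock (Orb (FermionTorus 2 L))),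
      Tendsto Ls atTop atTop →
      (∀ j, IsGroundStateInSector (hubbardTorusTT' (Ls j) 1 t'A UA) (rectN n (Ls j)) 0 (ψ (Ls j))) →
      (∀ j, star (ψ (Ls j)) ⬝ᵥ ψ (Ls j) = 1) → ω.IsTorusLimitOf ψ Ls →
      BA ≤ ω.meanEnergy (hubbardTTPrimeFermionInteraction 0 1 0) 1)
    {t'P UP : ℝ} (hU : UA < UP) (h₁ : UA * t'P ≤ t'A * (2 * UA - UP)) (h₂ : t'A * UP ≤ t'P * (2 * UP - UA))
    (c : ℚ) (hc : -((r : ℚ) : ℝ) - ((UP * t'A - UA * t'P) / (UP - UA) - 2 * t'A) * BA / 4 +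
      (2 * t'P - (UP * t'A - UA * t'P) / (UP - UA)) * 1.6211390 / 4 ≤ ((c : ℚ) : ℝ)) :
    ObsStiffnessSeqCeilingAt t'P UP n c := by
  refine ObsStiffnessSeqCeilingAt_on_apexRegion_of_fsumRow_of_le_diagHop Uo hUA hn0 hn2 hrow hu hBA hU h₁ h₂
    (BP := -(1.6211390 : ℝ)) (fun ω Ls ψ hLs hψ h1 hω => ?_) c ?_
  · have hN : ∀ j, IsNParticle (rectN n (Ls j)) (ψ (Ls j)) := fun j => ((mem_szSector_iff _ _ _).1 (hψ j).1).1
    exact (abs_le.1 (hω.abs_meanEnergy_diagHop_le_decimal hn0 hn2 hLs hN h1)).1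
  · have e : (2 * t'P - (UP * t'A - UA * t'P) / (UP - UA)) * -(1.6211390 : ℝ) / 4 =
        -((2 * t'P - (UP * t'A - UA * t'P) / (UP - UA)) * 1.6211390 / 4) := by ring
    rw [e]; linarith

end RegionKinematicTarget

/-! ## §6 (append, same seat) THREE stations, doped: the ladder edition (shorter overhangs, one `K₂` floor per station) -/

section ThreeStationsDoped

variable {U₁ U₂ U₃ Umax p q n : ℝ}

/-- **THE DOPED BOX FROM THREE STATIONS** `0 < U₁ ≤ U₂ ≤ U₃` (slabs `[U₁,U₂]`, `[U₂,U₃]`, `[U₃,U_max]`), targets `t′ ∈ [p, q]` (`q ≤ 0`), density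
`0 ≤ n < 2`: per station an unconditional f-sum orbit-lower family `valᵢ` on its source segment `[p(2 − Uᵢ/Uᵢ₊₁), q]` and a floor `Bᵢ ≤ K₂` there
(`Bᵢ ≤ 0`), priced by its own slab lever `(−p)(1 − Uᵢ/Uᵢ₊₁)`: then `ObsStiffnessSeqCeilingAt t′ U n c` on the whole box `[p, q] × [U₁, U_max]`. Shorter
overhangs and smaller levers than one station, at the cost of three bundle families and three `K₂` words (seat file `LA214E-STATION-LADDER.md`).
[cite: KomaTasaki1994, §1] [cite: ScalapinoWhiteZhang1993, §II] -/
theorem ObsStiffnessSeqCeilingAt_on_box_of_three_apexStations_orbitLower_of_le_diagHop (hU₁ : 0 < U₁) (h₁₂ : U₁ ≤ U₂)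
    (h₂₃ : U₂ ≤ U₃) (hq : q ≤ 0) (hn0 : 0 ≤ n) (hn2 : n < 2) (val₁ val₂ val₃ : ℝ → ℝ) {B₁ B₂ B₃ : ℝ}
    (hB₁0 : B₁ ≤ 0) (hB₂0 : B₂ ≤ 0) (hB₃0 : B₃ ≤ 0) (c : ℚ)
    (h₁ : ∀ s ∈ Set.Icc (p * (2 - U₁ / U₂)) q,
      ∀ (ω : InfVolFermionState 2) (Ls : ℕ → ℕ) (ψ : ∀ L, Fock (Orb (FermionTorus 2 L))),
      Tendsto Ls atTop atTop →
      (∀ j, IsGroundStateInSector (hubbardTorusTT' (Ls j) 1 s U₁) (rectN n (Ls j)) 0 (ψ (Ls j))) →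
      (∀ j, star (ψ (Ls j)) ⬝ᵥ ψ (Ls j) = 1) → ω.IsTorusLimitOf ψ Ls →
      val₁ s ≤ ((Finset.univ : Finset (DihedralGroup 4)).card : ℝ)⁻¹ * ∑ g ∈ (Finset.univ : Finset (DihedralGroup 4)),
        (ω.expect (d4ShiftSet g 0 (box 2 7)) (fermionEmbed (PolySite.d4Emb g 0 (box 2 7)) (-oddMomentObsTT s U₁ 0))).re)
    (hB₁ : ∀ s ∈ Set.Icc (p * (2 - U₁ / U₂)) q,
      ∀ (ω : InfVolFermionState 2) (Ls : ℕ → ℕ) (ψ : ∀ L, Fock (Orb (FermionTorus 2 L))),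
      Tendsto Ls atTop atTop →
      (∀ j, IsGroundStateInSector (hubbardTorusTT' (Ls j) 1 s U₁) (rectN n (Ls j)) 0 (ψ (Ls j))) →
      (∀ j, star (ψ (Ls j)) ⬝ᵥ ψ (Ls j) = 1) → ω.IsTorusLimitOf ψ Ls →
      B₁ ≤ ω.meanEnergy (hubbardTTPrimeFermionInteraction 0 1 0) 1)
    (hc₁ : ∀ s ∈ Set.Icc (p * (2 - U₁ / U₂)) q, -val₁ s + (-p) * (1 - U₁ / U₂) * (-B₁) / 2 ≤ ((c : ℚ) : ℝ))
    (h₂ : ∀ s ∈ Set.Icc (p * (2 - U₂ / U₃)) q,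
      ∀ (ω : InfVolFermionState 2) (Ls : ℕ → ℕ) (ψ : ∀ L, Fock (Orb (FermionTorus 2 L))),
      Tendsto Ls atTop atTop →
      (∀ j, IsGroundStateInSector (hubbardTorusTT' (Ls j) 1 s U₂) (rectN n (Ls j)) 0 (ψ (Ls j))) →
      (∀ j, star (ψ (Ls j)) ⬝ᵥ ψ (Ls j) = 1) → ω.IsTorusLimitOf ψ Ls →
      val₂ s ≤ ((Finset.univ : Finset (DihedralGroup 4)).card : ℝ)⁻¹ * ∑ g ∈ (Finset.univ : Finset (DihedralGroup 4)),
        (ω.expect (d4ShiftSet g 0 (box 2 7)) (fermionEmbed (PolySite.d4Emb g 0 (box 2 7)) (-oddMomentObsTT s U₂ 0))).re)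
    (hB₂ : ∀ s ∈ Set.Icc (p * (2 - U₂ / U₃)) q,
      ∀ (ω : InfVolFermionState 2) (Ls : ℕ → ℕ) (ψ : ∀ L, Fock (Orb (FermionTorus 2 L))),
      Tendsto Ls atTop atTop →
      (∀ j, IsGroundStateInSector (hubbardTorusTT' (Ls j) 1 s U₂) (rectN n (Ls j)) 0 (ψ (Ls j))) →
      (∀ j, star (ψ (Ls j)) ⬝ᵥ ψ (Ls j) = 1) → ω.IsTorusLimitOf ψ Ls →
      B₂ ≤ ω.meanEnergy (hubbardTTPrimeFermionInteraction 0 1 0) 1)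
    (hc₂ : ∀ s ∈ Set.Icc (p * (2 - U₂ / U₃)) q, -val₂ s + (-p) * (1 - U₂ / U₃) * (-B₂) / 2 ≤ ((c : ℚ) : ℝ))
    (h₃ : ∀ s ∈ Set.Icc (p * (2 - U₃ / Umax)) q,
      ∀ (ω : InfVolFermionState 2) (Ls : ℕ → ℕ) (ψ : ∀ L, Fock (Orb (FermionTorus 2 L))),
      Tendsto Ls atTop atTop →
      (∀ j, IsGroundStateInSector (hubbardTorusTT' (Ls j) 1 s U₃) (rectN n (Ls j)) 0 (ψ (Ls j))) →
      (∀ j, star (ψ (Ls j)) ⬝ᵥ ψ (Ls j) = 1) → ω.IsTorusLimitOf ψ Ls →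
      val₃ s ≤ ((Finset.univ : Finset (DihedralGroup 4)).card : ℝ)⁻¹ * ∑ g ∈ (Finset.univ : Finset (DihedralGroup 4)),
        (ω.expect (d4ShiftSet g 0 (box 2 7)) (fermionEmbed (PolySite.d4Emb g 0 (box 2 7)) (-oddMomentObsTT s U₃ 0))).re)
    (hB₃ : ∀ s ∈ Set.Icc (p * (2 - U₃ / Umax)) q,
      ∀ (ω : InfVolFermionState 2) (Ls : ℕ → ℕ) (ψ : ∀ L, Fock (Orb (FermionTorus 2 L))),
      Tendsto Ls atTop atTop →
      (∀ j, IsGroundStateInSector (hubbardTorusTT' (Ls j) 1 s U₃) (rectN n (Ls j)) 0 (ψ (Ls j))) →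
      (∀ j, star (ψ (Ls j)) ⬝ᵥ ψ (Ls j) = 1) → ω.IsTorusLimitOf ψ Ls →
      B₃ ≤ ω.meanEnergy (hubbardTTPrimeFermionInteraction 0 1 0) 1)
    (hc₃ : ∀ s ∈ Set.Icc (p * (2 - U₃ / Umax)) q, -val₃ s + (-p) * (1 - U₃ / Umax) * (-B₃) / 2 ≤ ((c : ℚ) : ℝ)) :
    ∀ tp ∈ Set.Icc p q, ∀ U ∈ Set.Icc U₁ Umax, ObsStiffnessSeqCeilingAt tp U n c := by
  intro tp htp U hU
  have hU₂ : 0 < U₂ := hU₁.trans_le h₁₂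
  have hU₃ : 0 < U₃ := hU₂.trans_le h₂₃
  rcases le_total U U₂ with hle₂ | hge₂
  · exact ObsStiffnessSeqCeilingAt_on_box_of_forall_apexStation_orbitLower_of_le_diagHop hU₁ hq hn0 hn2 val₁ hB₁0 c h₁ hB₁ hc₁
      tp htp U ⟨hU.1, hle₂⟩
  rcases le_total U U₃ with hle₃ | hge₃
  · exact ObsStiffnessSeqCeilingAt_on_box_of_forall_apexStation_orbitLower_of_le_diagHop hU₂ hq hn0 hn2 val₂ hB₂0 c h₂ hB₂ hc₂
      tp htp U ⟨hge₂, hle₃⟩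
  · exact ObsStiffnessSeqCeilingAt_on_box_of_forall_apexStation_orbitLower_of_le_diagHop hU₃ hq hn0 hn2 val₃ hB₃0 c h₃ hB₃ hc₃
      tp htp U ⟨hge₃, hU.2⟩

end ThreeStationsDoped

end Summit.Ventures.CertifiedManyBodySolver.Observables

end
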